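import Summits.PneNP.PneNP.Theorems.NegLimitedLoglogSlices
import Summits.PneNP.PneNP.Theorems.NegLimitedCliqueLikeNegLimitedLog

/-!
# Route NegLimited — R3R and R35: monotone slices of one explicit `L ∈ NP` beyond NOT budget `c·log₂log₂ n` and `Θ(log n / log log n)` (rung F-N1/p3)

For the witness language `L = NegLimSlices.witnessLang F` of `NegLimitedLoglogSlices.lean`
(`F` = the tree's proved GLS `ϑ`-routine; slices at `n = m²` are Tardos's `(⌊√m⌋-1, ⌊√m⌋)`-clique
function read on the strict upper triangle):
* `neglimitedAllCLoglogNegationsR` (**R3R**, the route-review repair of crux #3 with `Monotone`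
  slices): for every `c` and `k`, infinitely often the slice is monotone and needs `> n^k` De Morgan
  gates under `c·⌊log₂⌊log₂ n⌋⌋` NOT gates (engine: `cliqueLike_sqrt_negationLimited_sqrtLog`);
* `neglimitedLogOverLoglogNegations` (**R35**): the same `L`, NOT budget
  `⌊log₂ n⌋ / (40 (⌊log₂⌊log₂ n⌋⌋ + 1)) = Θ(log n / log log n)` (engine: T1
  `NegLimLog.cliqueLikeNegLimitedLog`; bridge `budgetR35_le_logBudget`).
Both are stated with explicit types; the by-name closers of the route items (once filed) are one
line each. Cell record: HOME/pnp-ideate-p3/NegLimSlices.lean, ROUND-3.md.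
-/

set_option linter.dupNamespace false -- `Summit.PneNP.PneNP.…`: summit = sub-problem name (D-0017 single-conjunct layout)

namespace Summit.PneNP.PneNP.Theorems.NegLimSlices

open Literature.Computability.Complexity Literature.Computability.Complexity.Brick
  Literature.Barriers.PneNP _root_.Computability Polynomial Filter Finset

variable {m : ℕ}

/-- The slices of the witness language at square lengths are monotone (`2 ≤ m`). -/
theorem monotone_sliceFn_witnessLang {F : List Bool → List Bool} (hF : IsThetaApprox F)
    (hm : 2 ≤ m) : Monotone ((witnessLang F).sliceFn (m * m)) := by
  intro x y hxy
  rw [sliceFn_witnessLang hF (by omega), sliceFn_witnessLang hF (by omega)]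
  have hk : 1 ≤ Nat.sqrt m := Nat.le_sqrt'.2 (by omega)
  exact (cliqueLike_tardosFn hm hk _ fun G => approxOf_spec hF (by omega) G).mono
    fun e => hxy (edgePos e)

/-- **R3R** (`NeglimitedAllCLoglogNegationsR`, the refuter-prescribed repair of crux #3 with
`Monotone` slices): one explicit `L ∈ NP` whose slices are, infinitely often, monotone and of
negation-limited complexity `> n^k` under `c·⌊log₂⌊log₂ n⌋⌋` NOT gates, for every `c` and `k`. -/
theorem neglimitedAllCLoglogNegationsR :
    ∀ c : ℕ, ∃ L ∈ Literature.Computability.Complexity.Nondeterministic.NP, ∀ k : ℕ,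
      ∃ᶠ n : ℕ in Filter.atTop, Monotone (L.sliceFn n) ∧ n ^ k <
        Literature.Computability.Complexity.negLimitedSizeOver
          Literature.Computability.Complexity.deMorganBasis (c * Nat.log 2 (Nat.log 2 n))
          (L.sliceFn n) := by
  obtain ⟨F, hF, hspec⟩ := GLS1981_thetaApprox_unary_FP_holds
  have hspec' : IsThetaApprox F := hspec
  intro c
  refine ⟨witnessLang F, witnessLang_mem_NP hF, fun k => frequently_of_eventually_sq ?_⟩
  filter_upwards [cliqueLike_sqrt_negationLimited_sqrtLog (2 * k + 1), eventually_ge_atTop 4,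
    tendsto_loglog.eventually_ge_atTop (max 64 (c + 2))] with m hm h4 hK
  have hb := budget_le_sqrtLogBudget (le_trans (le_max_left _ _) hK) (le_trans (le_max_right _ _) hK)
  have hle : m ^ (2 * k + 1) ≤ negLimitedSizeOver deMorganBasis (c * Nat.log 2 (Nat.log 2 (m * m)))
      ((witnessLang F).sliceFn (m * m)) :=
    le_negLimitedSizeOver_sliceFn hspec' h4 fun T hT D hD hDT hneg =>
      hm T hT D hD hDT (hneg.trans hb)
  refine ⟨monotone_sliceFn_witnessLang hspec' (by omega), ?_⟩
  calc (m * m) ^ k = m ^ (2 * k) := by rw [← pow_two, ← pow_mul]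
    _ < m ^ (2 * k + 1) := Nat.pow_lt_pow_right (by omega) (by omega)
    _ ≤ _ := hle

/-- `log₂ log₂ m ≤ log₂ log₂ (m²)`. -/
theorem loglog_le_loglog_sq (m : ℕ) : Nat.log 2 (Nat.log 2 m) ≤ Nat.log 2 (Nat.log 2 (m * m)) :=
  Nat.log_mono_right (Nat.log_mono_right (Nat.le_mul_self m))

/-- **The R35 budget bridge**: `⌊log₂ (m²)⌋ / (40 (⌊log₂⌊log₂ (m²)⌋⌋ + 1)) ≤ NegLimLog.logBudget m`. -/
theorem budgetR35_le_logBudget (m : ℕ) :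
    Nat.log 2 (m * m) / (40 * (Nat.log 2 (Nat.log 2 (m * m)) + 1)) ≤ NegLimLog.logBudget m := by
  unfold NegLimLog.logBudget
  set L := Nat.log 2 m
  set K := Nat.log 2 (Nat.log 2 m)
  set K' := Nat.log 2 (Nat.log 2 (m * m))
  have hK : K ≤ K' := loglog_le_loglog_sq m
  have h1 : Nat.log 2 (m * m) / (40 * (K' + 1)) ≤ (2 * L + 1) / (40 * (K + 1)) :=
    le_trans (Nat.div_le_div_right (log_sq_le m))
      (Nat.div_le_div_left (Nat.mul_le_mul_left 40 (by omega)) (by positivity))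
  refine le_trans h1 ?_
  rw [show 40 * (K + 1) = 2 * (20 * (K + 1)) by ring, ← Nat.div_div_eq_div_mul]
  exact Nat.div_le_div_right (by omega)

/-- **R35** (`NeglimitedLogOverLoglogNegations`): one explicit `L ∈ NP` whose slices are,
infinitely often, monotone and of negation-limited complexity `> n^k` under the NOT budget
`⌊log₂ n⌋ / (40 (⌊log₂⌊log₂ n⌋⌋ + 1)) = Θ(log n / log log n)`, for every `k` — from T1
(`NegLimLog.cliqueLikeNegLimitedLog`) through the slice plumbing. Print record for a single-output
function: `(1/6) log log n` (Amano–Maruoka 2005); tree record before T1: `Θ(√(log n)/log log n)`. -/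
theorem neglimitedLogOverLoglogNegations :
    ∃ L ∈ Literature.Computability.Complexity.Nondeterministic.NP, ∀ k : ℕ,
      ∃ᶠ n : ℕ in Filter.atTop, Monotone (L.sliceFn n) ∧ n ^ k <
        Literature.Computability.Complexity.negLimitedSizeOver
          Literature.Computability.Complexity.deMorganBasis
          (Nat.log 2 n / (40 * (Nat.log 2 (Nat.log 2 n) + 1))) (L.sliceFn n) := by
  obtain ⟨F, hF, hspec⟩ := GLS1981_thetaApprox_unary_FP_holds
  have hspec' : IsThetaApprox F := hspec
  refine ⟨witnessLang F, witnessLang_mem_NP hF, fun k => frequently_of_eventually_sq ?_⟩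
  filter_upwards [NegLimLog.cliqueLikeNegLimitedLog (2 * k + 1), eventually_ge_atTop 4] with m hm h4
  have hle : m ^ (2 * k + 1) ≤ negLimitedSizeOver deMorganBasis
      (Nat.log 2 (m * m) / (40 * (Nat.log 2 (Nat.log 2 (m * m)) + 1)))
      ((witnessLang F).sliceFn (m * m)) :=
    le_negLimitedSizeOver_sliceFn hspec' h4 fun T hT D hD hDT hneg =>
      hm T hT D hD hDT (hneg.trans (budgetR35_le_logBudget m))
  refine ⟨monotone_sliceFn_witnessLang hspec' (by omega), ?_⟩
  calc (m * m) ^ k = m ^ (2 * k) := by rw [← pow_two, ← pow_mul]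
    _ < m ^ (2 * k + 1) := Nat.pow_lt_pow_right (by omega) (by omega)
    _ ≤ _ := hle

end Summit.PneNP.PneNP.Theorems.NegLimSlices

namespace Summit.PneNP.PneNP.Theorems

/-- **stmt-PneNP-19657 (`NegLimited.NeglimitedLogOverLoglogNegations`, R35) PROVED, by name.**
[cite: AmanoMaruoka2005, §1] [cite: Jukna2012, §10.5 (PDF p. 310)] -/
theorem neglimitedLogOverLoglogNegations_holds :
    Summit.PneNP.PneNP.Theses.NegLimited.NeglimitedLogOverLoglogNegations :=
  NegLimSlices.neglimitedLogOverLoglogNegations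

/-- **stmt-PneNP-19658 (`NegLimited.NeglimitedAllCLoglogNegationsR`, R3R) PROVED, by name.**
[cite: AmanoMaruoka2005, §1] -/
theorem neglimitedAllCLoglogNegationsR_holds :
    Summit.PneNP.PneNP.Theses.NegLimited.NeglimitedAllCLoglogNegationsR :=
  NegLimSlices.neglimitedAllCLoglogNegationsR

end Summit.PneNP.PneNP.Theorems
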